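import Literature.Computability.MetaComplexity.AvgPOfAvgPLevin
import Literature.Computability.MetaComplexity.AvgPLevinOfAvgP
import HarnessLib

/-!
# `AvgP = AvgPLevin` for ensembles with polynomially bounded support: the discharge of
# `mem_AvgP_iff_mem_AvgPLevin`

Topic `Literature/Computability/MetaComplexity`, sibling proof file of `DistProblems.lean` (D-0014:
the named fact `def mem_AvgP_iff_mem_AvgPLevin : Prop` is discharged as
`theorem mem_AvgP_iff_mem_AvgPLevin_holds`). The two directions live in their own files (each a
machine construction):

* `AvgPOfAvgPLevin.lean` — `mem_AvgP_of_mem_AvgPLevin : Q ∈ AvgPLevin → Q ∈ AvgP` for every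
  ensemble (clocked simulation of the average-polynomial machine for `((c+1)(n+1)m)^⌈1/ε⌉` steps
  via the clocked universal acceptance test; failure probability `≤ 1/m` by Markov's inequality);
* `AvgPLevinOfAvgP.lean` — `mem_AvgPLevin_of_mem_AvgP : Q.dist.HasPolyLength → Q ∈ AvgP →
  Q ∈ AvgPLevin` (the doubling search `A(x; n, 1/2), A(x; n, 1/4), …` until the scheme answers,
  as a loop-until-flag machine; average polynomial running time by the tail bound
  `Pr[more than k rounds] ≤ 2⁻ᵏ`).

This file only assembles them into the printed equivalence (Bogdanov–Trevisan 2006, §2.2.1,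
Prop. 7 of arXiv cs/0606037v2 = Prop. 2.6 of the journal numbering cited in `DistProblems.lean`:
"a distributional problem admits a fully polynomial-time errorless heuristic scheme if and only if
it admits an algorithm whose running time is average-polynomial", under the survey's standing
convention `|x| ≤ poly(n)` on `supp Dₙ`, here the hypothesis `Ensemble.HasPolyLength`;
Impagliazzo 1995, §2, Prop. 2). Neither this file nor the two halves can be merged into
`DistProblemsProofs.lean`, which both halves import.

## References

* A. Bogdanov, L. Trevisan, *Average-Case Complexity*, Found. Trends TCS 2 (2006) 1–106, §2.2.1
  (arXiv cs/0606037v2: Def. 4, Prop. 5, Def. 6, Prop. 7, Def. 8). doi:10.1561/0400000004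
* R. Impagliazzo, *A personal view of average-case complexity*, Structure in Complexity Theory
  Conference 1995, §2, Prop. 2. doi:10.1109/sct.1995.514853
* L. Levin, *Average case complete problems*, SIAM J. Comput. 15 (1986) 285–286.
-/

namespace Literature.Computability.MetaComplexity

/-- **Discharge of `mem_AvgP_iff_mem_AvgPLevin`** (Bogdanov–Trevisan 2006, §2.2.1, Prop. 7 of
arXiv cs/0606037v2; Impagliazzo 1995, Prop. 2): for a distributional problem `(L, D)` whose
ensemble has polynomially bounded support lengths, `(L, D)` has an errorless heuristic scheme
(`AvgP`, Bogdanov–Trevisan Def. 6/8) iff it is decidable in Levin's average polynomial time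
(`AvgPLevin`, Def. 4). The forward direction is `mem_AvgPLevin_of_mem_AvgP` (doubling search,
uses `HasPolyLength`), the backward direction `mem_AvgP_of_mem_AvgPLevin` (clocked simulation,
holds for every ensemble).
[cite: BogdanovTrevisan2006, §2.2.1, Prop. 7 (arXiv cs/0606037v2) = Prop. 2.6] -/
theorem mem_AvgP_iff_mem_AvgPLevin_holds : mem_AvgP_iff_mem_AvgPLevin := by
  intro Q hlen
  exact ⟨mem_AvgPLevin_of_mem_AvgP hlen, mem_AvgP_of_mem_AvgPLevin⟩

end Literature.Computability.MetaComplexity
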